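import Literature.Probability.LatticeModels.KilledHarmonicRatio
import HarnessLib

/-!
# Hub factorisation of exit kernels: hitting probabilities, the lower bound, and the separator decomposition

Topic `Literature/Probability/LatticeModels` (continuation of `KilledWalkLaplacian.lean`,
`KilledHarmonicRatio.lean`). For a finite region `Λ` of the edge-killed walk `Gr`, a set of sites
`B ⊆ Λ` (the "hub ball") and an exit point `x ∉ Λ`, Chelkak's factorisation of the exit kernel
through the hub reads `P_Λ(m,x) ≍ P_m[hit B before leaving Λ] · P_Λ(u,x)` (Chelkak 2016,
Proposition 3.1 with Proposition 3.3 / Theorem 3.5). This file provides the analytic skeleton: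

* `hitProb Gr Λ B` — the probability to hit `B` before leaving `Λ`, as the killed-harmonic
  extension to `Λ ∖ B` of the indicator of `B`; values in `[0,1]`, `= 1` on `B`, monotone in `B`
  and in the region, and the **strong Markov comparison** `hitProb Λ B' ≤ θ⁻¹ hitProb Λ B` when
  `hitProb Λ B ≥ θ` on `B'` (`mul_hitProb_le_of_le_on`);
* the **lower bound** (`mul_hitProb_le_killedPoisson`): if `ℓ ≤ P_Λ(w,x)` on `B` then
  `ℓ · hitProb(m) ≤ P_Λ(m,x)` on `Λ` (first hit `B`, then exit at `x`);
* the **separator decomposition** (`killedPoisson_le_separator`): for `W ⊆ Λ ∖ B`,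
  `P_Λ(m,x) ≤ P_{Λ∖(B∪W)}(m,x) + (sup_B P_Λ(·,x)) · hitProb_B(m) + ∑_{w ∈ W} P_{Λ∖(B∪W)}(m,w) P_Λ(w,x)`
  (the first term vanishes when `B ∪ W` separates `m` from `x`), and the bound of a wall piece
  `W' ⊆ W` through the hub (`sum_wall_le`):
  `∑_{w ∈ W'} P_{Λ∖(B∪W)}(m,w) P_Λ(w,x) ≤ (sup_{W'} P_Λ(·,x)) · θ⁻¹ · hitProb_B(m)` when
  `hitProb_B ≥ θ` on `W'`.

Everything is proved (maximum principle only). [cite: Chelkak2016, §3.1–3.2]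
-/

noncomputable section

open scoped Classical

namespace Literature.Probability.LatticeModels

open Finset

variable {Gr : SimpleGraph (Site 2)}

/-! ### Hitting probabilities -/

/-- `hitProb Gr Λ B m`: the probability that the walk from `m`, killed on leaving `Λ`, hits `B`
(the killed-harmonic extension to `Λ ∖ B` of the indicator of `B`). [cite: Chelkak2016, §3.1] -/
def hitProb (Gr : SimpleGraph (Site 2)) (Λ B : Set (Site 2)) : Site 2 → ℝ :=
  killedHarmExt Gr (Λ \ B) (fun w => if w ∈ B then 1 else 0)

/-- `hitProb` is killed-harmonic on `Λ ∖ B`. [folklore] -/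
theorem hitProb_harmonicOn {Λ B : Set (Site 2)} (hΛ : Λ.Finite) : IsKilledHarmonicOn Gr (hitProb Gr Λ B) (Λ \ B) :=
  killedHarmExt_harmonicOn (hΛ.subset fun _ hz => hz.1) _

/-- Off `Λ ∖ B`, `hitProb` is the indicator of `B`. [folklore] -/
theorem hitProb_of_not_mem {Λ B : Set (Site 2)} {w : Site 2} (hw : w ∉ Λ \ B) :
    hitProb Gr Λ B w = if w ∈ B then 1 else 0 :=
  killedHarmExt_of_not_mem _ hw

/-- `hitProb = 1` on `B`. [folklore] -/
theorem hitProb_of_mem {Λ B : Set (Site 2)} {w : Site 2} (hw : w ∈ B) : hitProb Gr Λ B w = 1 := by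
  rw [hitProb_of_not_mem fun h => h.2 hw, if_pos hw]

/-- `0 ≤ hitProb`. [folklore] -/
theorem hitProb_nonneg {Λ B : Set (Site 2)} (hΛ : Λ.Finite) (w : Site 2) : 0 ≤ hitProb Gr Λ B w :=
  killedHarmExt_nonneg (hΛ.subset fun _ hz => hz.1) (fun w => by split_ifs <;> norm_num) w

/-- `hitProb ≤ 1`. [folklore] -/
theorem hitProb_le_one {Λ B : Set (Site 2)} (hΛ : Λ.Finite) (w : Site 2) : hitProb Gr Λ B w ≤ 1 :=
  killedHarmExt_le' (hΛ.subset fun _ hz => hz.1) zero_le_one (fun w => by split_ifs <;> norm_num) w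

/-- **Strong Markov comparison.** If `hitProb_B ≥ θ` on `B'` (with `0 < θ ≤ 1`), then
`θ · hitProb_{B'} ≤ hitProb_B` everywhere: to hit `B` it suffices to hit `B'` and then `B`.
[cite: Chelkak2016, §3.2] -/
theorem mul_hitProb_le_of_le_on {Λ B B' : Set (Site 2)} (hΛ : Λ.Finite) {θ : ℝ} (hθ0 : 0 < θ) (hθ1 : θ ≤ 1)
    (hB' : ∀ w ∈ B', θ ≤ hitProb Gr Λ B w) (w : Site 2) : θ * hitProb Gr Λ B' w ≤ hitProb Gr Λ B w := by
  -- compare on the region `Λ ∖ (B ∪ B')`, where both are killed-harmonic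
  set S := Λ \ (B ∪ B') with hS
  have hSfin : S.Finite := hΛ.subset fun _ hz => hz.1
  by_cases hw : w ∈ S
  · have h1 : IsKilledHarmonicOn Gr (fun z => θ * hitProb Gr Λ B' z) S :=
      ((hitProb_harmonicOn hΛ).mono (fun z hz => ⟨hz.1, fun h => hz.2 (Or.inr h)⟩)).const_mul θ
    have h2 : IsKilledHarmonicOn Gr (hitProb Gr Λ B) S :=
      (hitProb_harmonicOn hΛ).mono fun z hz => ⟨hz.1, fun h => hz.2 (Or.inl h)⟩
    refine le_of_killedSub_killedSuper_of_boundary hSfin h1.subharmonicOn h2.superharmonicOn ?_ w hw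
    intro z hz
    have hzS : z ∉ S := hz.1
    by_cases hzB : z ∈ B
    · rw [hitProb_of_mem hzB]
      exact (mul_le_of_le_one_right hθ0.le (hitProb_le_one hΛ z)).trans hθ1
    by_cases hzB' : z ∈ B'
    · rw [hitProb_of_mem hzB', mul_one]; exact hB' z hzB'
    · have hzΛ : z ∉ Λ := fun h => hzS ⟨h, fun h' => h'.elim hzB hzB'⟩
      rw [hitProb_of_not_mem (fun h => hzΛ h.1), if_neg hzB', mul_zero]
      exact hitProb_nonneg hΛ z
  · -- off the region: `w ∈ B`, `w ∈ B'`, or `w ∉ Λ`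
    by_cases hwB : w ∈ B
    · rw [hitProb_of_mem hwB]
      exact (mul_le_of_le_one_right hθ0.le (hitProb_le_one hΛ w)).trans hθ1
    by_cases hwB' : w ∈ B'
    · rw [hitProb_of_mem hwB', mul_one]; exact hB' w hwB'
    · have hwΛ : w ∉ Λ := fun h => hw ⟨h, fun h' => h'.elim hwB hwB'⟩
      rw [hitProb_of_not_mem (fun h => hwΛ h.1), if_neg hwB', mul_zero]
      exact hitProb_nonneg hΛ w

/-! ### The lower bound: first hit the hub, then exit -/

/-- **Lower bound of the factorisation.** If `ℓ ≤ P_Λ(w,x)` for all `w ∈ B`, then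
`ℓ · hitProb_B(m) ≤ P_Λ(m,x)` for every `m`. [cite: Chelkak2016, Prop. 3.1] -/
theorem mul_hitProb_le_killedPoisson {Λ B : Set (Site 2)} (hΛ : Λ.Finite) {x : Site 2}
    {ℓ : ℝ} (hℓ : ∀ w ∈ B, ℓ ≤ killedPoisson Gr Λ w x) (m : Site 2) :
    ℓ * hitProb Gr Λ B m ≤ killedPoisson Gr Λ m x := by
  have hSfin : (Λ \ B).Finite := hΛ.subset fun _ hz => hz.1
  by_cases hm : m ∈ Λ \ B
  · have h1 : IsKilledHarmonicOn Gr (fun z => ℓ * hitProb Gr Λ B z) (Λ \ B) := (hitProb_harmonicOn hΛ).const_mul ℓ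
    have h2 : IsKilledHarmonicOn Gr (fun z => killedPoisson Gr Λ z x) (Λ \ B) :=
      (killedPoisson_harmonicOn hΛ x).mono fun _ hz => hz.1
    refine le_of_killedSub_killedSuper_of_boundary hSfin h1.subharmonicOn h2.superharmonicOn ?_ m hm
    intro z hz
    by_cases hzB : z ∈ B
    · rw [hitProb_of_mem hzB, mul_one]; exact hℓ z hzB
    · have hzΛ : z ∉ Λ := fun h => hz.1 ⟨h, hzB⟩
      rw [hitProb_of_not_mem (fun h => hzΛ h.1), if_neg hzB, mul_zero]
      exact killedPoisson_nonneg hΛ z x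
  · by_cases hmB : m ∈ B
    · rw [hitProb_of_mem hmB, mul_one]; exact hℓ m hmB
    · have hmΛ : m ∉ Λ := fun h => hm ⟨h, hmB⟩
      rw [hitProb_of_not_mem (fun h => hmΛ h.1), if_neg hmB, mul_zero]
      exact killedPoisson_nonneg hΛ m x

/-! ### The separator decomposition -/

/-- **First-entrance decomposition over `B ∪ W`.** For `B, W ⊆ Λ` (finite), `x ∉ Λ` and
`m ∈ Λ ∖ (B ∪ W)`:
`P_Λ(m,x) = P_{S}(m,x) + ∑_{w ∈ (B ∪ W) ∩ ∂S} P_{S}(m,w) P_Λ(w,x)` with `S = Λ ∖ (B ∪ W)`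
(the exits of `S` are `x`-or-not exits of `Λ`, where `P_Λ(·,x)` is the indicator of `x`, and
sites of `B ∪ W`). Stated as the inequality with the `B`-part bounded through `sup_B P_Λ(·,x)` and
the hitting probability of `B`. [cite: Chelkak2016, §3.2] -/
theorem killedPoisson_le_separator {Λ B W : Set (Site 2)} (hΛ : Λ.Finite) (hBΛ : B ⊆ Λ)
    {x : Site 2} (hx : x ∉ Λ) {M : ℝ} (hM0 : 0 ≤ M) (hM : ∀ w ∈ B, killedPoisson Gr Λ w x ≤ M)
    (Wf : Finset (Site 2)) (hWf : ∀ w, w ∈ Wf ↔ w ∈ W) {m : Site 2} (hm : m ∈ Λ \ (B ∪ W)) :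
    killedPoisson Gr Λ m x ≤ killedPoisson Gr (Λ \ (B ∪ W)) m x + M * hitProb Gr Λ B m +
      ∑ w ∈ Wf, killedPoisson Gr (Λ \ (B ∪ W)) m w * killedPoisson Gr Λ w x := by
  set S := Λ \ (B ∪ W) with hS
  have hSfin : S.Finite := hΛ.subset fun _ hz => hz.1
  set E := (killedOuterBoundary_finite (Gr := Gr) hSfin).toFinset with hE
  have hmemE : ∀ w, w ∈ E ↔ w ∈ killedOuterBoundary Gr S := fun w => Set.Finite.mem_toFinset _
  -- representation of `P_Λ(·,x)` on `S`
  have hrep := ((killedPoisson_harmonicOn (Gr := Gr) hΛ x).mono (fun z (hz : z ∈ S) => hz.1)).eq_sum_killedPoisson hSfin m hm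
  rw [hrep]
  -- split the exit set of `S` into: exits of `Λ`, sites of `B`, sites of `W ∖ B`
  have hsplit : ∀ w ∈ E, killedPoisson Gr S m w * killedPoisson Gr Λ w x =
      (if w ∉ Λ then killedPoisson Gr S m w * killedPoisson Gr Λ w x else 0) +
      (if w ∈ B then killedPoisson Gr S m w * killedPoisson Gr Λ w x else 0) +
      (if w ∈ Λ ∧ w ∉ B then killedPoisson Gr S m w * killedPoisson Gr Λ w x else 0) := by
    intro w _
    by_cases h1 : w ∈ Λ
    · by_cases h2 : w ∈ B
      · simp [h1, h2]
      · simp [h1, h2]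
    · have h2 : w ∉ B := fun h => h1 (hBΛ h)
      simp [h1, h2]
  rw [Finset.sum_congr rfl hsplit, Finset.sum_add_distrib, Finset.sum_add_distrib]
  refine add_le_add (add_le_add ?_ ?_) ?_
  · -- exits of `Λ`: `P_Λ(w,x) = 𝟙[w = x]`, so the sum is the single term `P_S(m,x)` (or `0`)
    rw [← Finset.sum_filter]
    by_cases hxE : x ∈ E.filter (fun w => w ∉ Λ)
    · rw [Finset.sum_eq_single_of_mem x hxE]
      · rw [killedPoisson_of_not_mem hx, if_pos rfl, mul_one]
      · intro w hw hwx
        rw [Finset.mem_filter] at hw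
        rw [killedPoisson_of_not_mem hw.2, if_neg hwx, mul_zero]
    · rw [Finset.sum_eq_zero]
      · exact killedPoisson_nonneg hSfin m x
      · intro w hw
        have hwx : w ≠ x := fun h => hxE (h ▸ hw)
        rw [Finset.mem_filter] at hw
        rw [killedPoisson_of_not_mem hw.2, if_neg hwx, mul_zero]
  · -- sites of `B`: bounded by `M ·` (the `S`-probability of entering `B`) `≤ M · hitProb_B(m)`
    calc ∑ w ∈ E, (if w ∈ B then killedPoisson Gr S m w * killedPoisson Gr Λ w x else 0)
        ≤ ∑ w ∈ E, (if w ∈ B then killedPoisson Gr S m w * M else 0) := by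
          refine Finset.sum_le_sum fun w _ => ?_
          split_ifs with h
          · exact mul_le_mul_of_nonneg_left (hM w h) (killedPoisson_nonneg hSfin m w)
          · exact le_rfl
      _ = M * ∑ w ∈ E, killedPoisson Gr S m w * (if w ∈ B then 1 else 0) := by
          rw [Finset.mul_sum]
          refine Finset.sum_congr rfl fun w _ => ?_
          split_ifs <;> ring
      _ = M * killedHarmExt Gr S (fun w => if w ∈ B then 1 else 0) m := by
          rw [killedHarmExt_eq_sum_killedPoisson hSfin _ m hm]
      _ ≤ M * hitProb Gr Λ B m := by
          refine mul_le_mul_of_nonneg_left ?_ hM0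
          -- `S ⊆ Λ ∖ B`: compare the two extensions on `S`
          have h1 : IsKilledHarmonicOn Gr (killedHarmExt Gr S fun w => if w ∈ B then (1 : ℝ) else 0) S :=
            killedHarmExt_harmonicOn hSfin _
          have h2 : IsKilledHarmonicOn Gr (hitProb Gr Λ B) S :=
            (hitProb_harmonicOn hΛ).mono fun z hz => ⟨hz.1, fun h => hz.2 (Or.inl h)⟩
          refine le_of_killedSub_killedSuper_of_boundary hSfin h1.subharmonicOn h2.superharmonicOn ?_ m hm
          intro z hz
          rw [killedHarmExt_of_not_mem _ hz.1]
          by_cases hzB : z ∈ B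
          · rw [if_pos hzB, hitProb_of_mem hzB]
          · rw [if_neg hzB]; exact hitProb_nonneg hΛ z
  · -- sites of `W ∖ B`: a sub-sum of the sum over `Wf` of nonnegative terms
    have hsub : ∀ w ∈ E, (if w ∈ Λ ∧ w ∉ B then killedPoisson Gr S m w * killedPoisson Gr Λ w x else 0) =
        (if w ∈ Wf then (if w ∈ Λ ∧ w ∉ B then killedPoisson Gr S m w * killedPoisson Gr Λ w x else 0) else 0) := by
      intro w hw
      by_cases hwW : w ∈ Wf
      · rw [if_pos hwW]
      · rw [if_neg hwW]
        split_ifs with h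
        · exfalso
          have hwS : w ∉ S := ((hmemE w).1 hw).1
          exact hwS ⟨h.1, fun h' => h'.elim h.2 fun hW => hwW ((hWf w).2 hW)⟩
        · rfl
    rw [Finset.sum_congr rfl hsub, ← Finset.sum_filter]
    calc ∑ w ∈ E.filter (fun w => w ∈ Wf), (if w ∈ Λ ∧ w ∉ B then killedPoisson Gr S m w * killedPoisson Gr Λ w x else 0)
        ≤ ∑ w ∈ E.filter (fun w => w ∈ Wf), killedPoisson Gr S m w * killedPoisson Gr Λ w x := by
          refine Finset.sum_le_sum fun w _ => ?_
          split_ifs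
          · exact le_rfl
          · exact mul_nonneg (killedPoisson_nonneg hSfin m w) (killedPoisson_nonneg hΛ w x)
      _ ≤ ∑ w ∈ Wf, killedPoisson Gr S m w * killedPoisson Gr Λ w x := by
          refine Finset.sum_le_sum_of_subset_of_nonneg (fun w hw => (Finset.mem_filter.1 hw).2) ?_
          intro w _ _
          exact mul_nonneg (killedPoisson_nonneg hSfin m w) (killedPoisson_nonneg hΛ w x)

/-- **A wall piece through the hub.** If `hitProb_B ≥ θ` on `W' ⊆ Wf` (`0 < θ ≤ 1`) and
`P_Λ(·,x) ≤ M'` on `W'`, then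
`∑_{w ∈ W'} P_{Λ∖(B∪W)}(m,w) P_Λ(w,x) ≤ M' θ⁻¹ hitProb_B(m)`: the walk entering `B ∪ W` through
`W'` has hit `W'`, whence it hits `B` with probability `≥ θ`. [cite: Chelkak2016, §3.2] -/
theorem sum_wall_le {Λ B W : Set (Site 2)} (hΛ : Λ.Finite) {x : Site 2}
    (W' : Finset (Site 2)) (hW'W : ∀ w ∈ W', w ∈ W) {M' θ : ℝ} (hM'0 : 0 ≤ M') (hθ0 : 0 < θ) (hθ1 : θ ≤ 1)
    (hM' : ∀ w ∈ W', killedPoisson Gr Λ w x ≤ M') (hθ : ∀ w ∈ W', θ ≤ hitProb Gr Λ B w)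
    {m : Site 2} (hm : m ∈ Λ \ (B ∪ W)) :
    ∑ w ∈ W', killedPoisson Gr (Λ \ (B ∪ W)) m w * killedPoisson Gr Λ w x ≤ M' * θ⁻¹ * hitProb Gr Λ B m := by
  set S := Λ \ (B ∪ W) with hS
  have hSfin : S.Finite := hΛ.subset fun _ hz => hz.1
  -- bound `P_Λ(w,x) ≤ M'` termwise, then the entrance sum by the hitting probability of `W'`
  have h1 : ∑ w ∈ W', killedPoisson Gr S m w * killedPoisson Gr Λ w x ≤ M' * ∑ w ∈ W', killedPoisson Gr S m w := by
    rw [Finset.mul_sum]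
    refine Finset.sum_le_sum fun w hw => ?_
    rw [mul_comm M']
    exact mul_le_mul_of_nonneg_left (hM' w hw) (killedPoisson_nonneg hSfin m w)
  -- the entrance sum is at most `hitProb Λ W'`
  have h2 : ∑ w ∈ W', killedPoisson Gr S m w ≤ hitProb Gr Λ (↑W' : Set (Site 2)) m := by
    have hrep : ∑ w ∈ W', killedPoisson Gr S m w =
        killedHarmExt Gr S (fun w => if w ∈ (↑W' : Set (Site 2)) then 1 else 0) m := by
      rw [killedHarmExt_eq_sum_killedPoisson hSfin _ m hm]
      set E := (killedOuterBoundary_finite (Gr := Gr) hSfin).toFinset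
      have hmemE : ∀ w, w ∈ E ↔ w ∈ killedOuterBoundary Gr S := fun w => Set.Finite.mem_toFinset _
      -- terms of `W'` outside the exit set of `S` vanish (Poisson kernel with pole off the boundary)
      rw [show ∑ w ∈ E, killedPoisson Gr S m w * (if w ∈ (↑W' : Set (Site 2)) then (1 : ℝ) else 0) =
          ∑ w ∈ E.filter (fun w => w ∈ W'), killedPoisson Gr S m w from by
        rw [Finset.sum_filter]
        refine Finset.sum_congr rfl fun w _ => ?_
        simp only [Finset.mem_coe]
        split_ifs <;> simp]
      refine (Finset.sum_subset (fun w hw => (Finset.mem_filter.1 hw).2) ?_).symm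
      intro w hw hw'
      have hwE : w ∉ killedOuterBoundary Gr S := fun h => hw' (Finset.mem_filter.2 ⟨(hmemE w).2 h, hw⟩)
      exact killedPoisson_eq_zero_of_not_mem_boundary hSfin hwE m hm
    rw [hrep]
    have ha : IsKilledHarmonicOn Gr (killedHarmExt Gr S fun w => if w ∈ (↑W' : Set (Site 2)) then (1 : ℝ) else 0) S :=
      killedHarmExt_harmonicOn hSfin _
    have hb : IsKilledHarmonicOn Gr (hitProb Gr Λ (↑W' : Set (Site 2))) S :=
      (hitProb_harmonicOn hΛ).mono fun z hz => ⟨hz.1, fun h => hz.2 (Or.inr (hW'W z h))⟩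
    refine le_of_killedSub_killedSuper_of_boundary hSfin ha.subharmonicOn hb.superharmonicOn ?_ m hm
    intro z hz
    rw [killedHarmExt_of_not_mem _ hz.1]
    by_cases hzW : z ∈ (↑W' : Set (Site 2))
    · rw [if_pos hzW, hitProb_of_mem hzW]
    · rw [if_neg hzW]; exact hitProb_nonneg hΛ z
  -- strong Markov: `θ hitProb_{W'} ≤ hitProb_B`
  have h3 : θ * hitProb Gr Λ (↑W' : Set (Site 2)) m ≤ hitProb Gr Λ B m :=
    mul_hitProb_le_of_le_on hΛ hθ0 hθ1 (fun w hw => hθ w hw) m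
  calc ∑ w ∈ W', killedPoisson Gr S m w * killedPoisson Gr Λ w x
      ≤ M' * ∑ w ∈ W', killedPoisson Gr S m w := h1
    _ ≤ M' * hitProb Gr Λ (↑W' : Set (Site 2)) m := mul_le_mul_of_nonneg_left h2 hM'0
    _ = M' * θ⁻¹ * (θ * hitProb Gr Λ (↑W' : Set (Site 2)) m) := by field_simp
    _ ≤ M' * θ⁻¹ * hitProb Gr Λ B m := mul_le_mul_of_nonneg_left h3 (mul_nonneg hM'0 (inv_nonneg.2 hθ0.le))

end Literature.Probability.LatticeModels
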